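import Summits.ValiantsHypothesis.ValiantsHypothesis.Theorems.LacunarySymmetroidMatrixDescartesCensusNoBilinearLaw

/-!
# The stub set of line `sign-split` (crux `MatrixDescartes`, stmt-18050) is inconsistent

Token-identical restatements of three statements of `Cruxes/MatrixDescartes/Lines/sign_split.lean`
(`PerturbToAlternation` = `stub_perturb`, `SplitToSemidefinite` = `stub_split`,
`BilinearSemidefiniteDescartes` = `stub_bmd`), and the kernel fact

  `SplitToSemidefinite → PerturbToAlternation → ¬ BilinearSemidefiniteDescartes`.

Mechanism: Steps A–B of that line's own glue (`matrixDescartes_of_stubs`) turn the bilinear semidefinite rule into the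
bilinear-in-logs law `Z₊(m,K) ≤ 2·2^{a(log₂ m+1)(log₂ K+2)} ≤ 2^{(2a+1)(log₂ m+1)(log₂ K+1)}` for ALL symmetric pencils,
which `Census.noGo_bilinearLogLaw` (doubled kernel staircase) refutes.  Reading: modulo the two T8 stubs the law stub
`stub_bmd` is false as typed; its consistent re-typing is B-shaped (`2^{C(K'+log₂² m)}`).  Desk ASK R2338.
0 sorry · 0 axiom · no Cruxes import.
-/

set_option linter.dupNamespace false
set_option linter.unusedVariables false

namespace Summit.ValiantsHypothesis.ValiantsHypothesis.Theorems.LacunarySymmetroidMatrixDescartes.Census.SignSplit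

open Polynomial Matrix Finset Filter Topology
open scoped BigOperators
open Summit.ValiantsHypothesis.ValiantsHypothesis.Theorems.MatrixDescartes.Negative (PosRootLawAt)

/-! ## Vocabulary (verbatim from `Lines/sign_split.lean`) -/

/-- The lacunary pencil `Σ_l X^{d_l} • S_l` (verbatim the crux's expression). -/
noncomputable def pencil {K m : ℕ} (d : Fin K → ℕ) (S : Fin K → Matrix (Fin m) (Fin m) ℝ) :
    Matrix (Fin m) (Fin m) ℝ[X] :=
  ∑ l, (X : ℝ[X]) ^ d l • (S l).map C

/-- Number of distinct POSITIVE real roots of `det` of the pencil (`Z₊`). -/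
noncomputable def posRootCount {K m : ℕ} (d : Fin K → ℕ) (S : Fin K → Matrix (Fin m) (Fin m) ℝ) : ℕ :=
  ((pencil d S).det.roots.toFinset.filter (fun t => 0 < t)).card

/-- Strict sign alternation of `det` of the pencil along positive test points `τ 0 < ⋯ < τ N`. -/
def Alternates {K m : ℕ} (d : Fin K → ℕ) (S : Fin K → Matrix (Fin m) (Fin m) ℝ)
    (N : ℕ) (τ : Fin (N + 1) → ℝ) : Prop :=
  StrictMono τ ∧ (∀ j, 0 < τ j) ∧
    ∀ j : Fin N, (pencil d S).det.eval (τ j.castSucc) * (pencil d S).det.eval (τ j.succ) < 0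

/-- A signed family of matrices: `σ_l = true ↦ +A_l`, `false ↦ −A_l`. -/
noncomputable def signed {K m : ℕ} (σ : Fin K → Bool) (A : Fin K → Matrix (Fin m) (Fin m) ℝ) :
    Fin K → Matrix (Fin m) (Fin m) ℝ :=
  fun l => (if σ l then (1 : ℝ) else -1) • A l

/-- Number of sign changes `V` of a sign word read in index order. -/
noncomputable def signChanges {K : ℕ} (σ : Fin K → Bool) : ℕ :=
  (Finset.univ.filter fun i : Fin (K - 1) =>
    σ ⟨i.val, lt_of_lt_of_le i.isLt (Nat.sub_le K 1)⟩ ≠ σ ⟨i.val + 1, Nat.add_lt_of_lt_sub i.isLt⟩).card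

/-- `V ≤ K − 1`. [verbatim from `sign_split.lean`] -/
theorem signChanges_le {K : ℕ} (σ : Fin K → Bool) : signChanges σ ≤ K - 1 := by
  unfold signChanges
  exact (Finset.card_le_univ _).trans_eq (Fintype.card_fin _)

/-! ## The three statements (verbatim) -/

/-- `stub_perturb` of `sign_split.lean`, verbatim. -/
def PerturbToAlternation : Prop :=
  ∀ (K m : ℕ) (d : Fin K → ℕ) (B : ℕ),
    (∀ S : Fin K → Matrix (Fin m) (Fin m) ℝ, (∀ l, (S l).IsSymm) →
        ∀ (N : ℕ) (τ : Fin (N + 1) → ℝ), Alternates d S N τ → N ≤ B) →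
    ∀ S : Fin K → Matrix (Fin m) (Fin m) ℝ, (∀ l, (S l).IsSymm) → posRootCount d S ≤ 2 * B

/-- `stub_split` of `sign_split.lean`, verbatim. -/
def SplitToSemidefinite : Prop :=
  ∀ (K m : ℕ) (d : Fin K → ℕ) (S : Fin K → Matrix (Fin m) (Fin m) ℝ), (∀ l, (S l).IsSymm) →
    ∀ (N : ℕ) (τ : Fin (N + 1) → ℝ), Alternates d S N τ →
      ∃ (K' : ℕ) (d' : Fin K' → ℕ) (σ : Fin K' → Bool) (A : Fin K' → Matrix (Fin m) (Fin m) ℝ),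
        K' ≤ 2 * K ∧ StrictMono d' ∧ (∀ l, (A l).PosSemidef) ∧ N ≤ posRootCount d' (signed σ A)

/-- `stub_bmd` of `sign_split.lean` (the bilinear semidefinite matrix Descartes rule), verbatim. -/
def BilinearSemidefiniteDescartes : Prop :=
  ∃ a : ℕ, ∀ (K m : ℕ) (d : Fin K → ℕ) (σ : Fin K → Bool) (A : Fin K → Matrix (Fin m) (Fin m) ℝ),
    StrictMono d → (∀ l, (A l).PosSemidef) →
      posRootCount d (signed σ A) ≤ 2 ^ (a * (Nat.log 2 m + 1) * (Nat.log 2 (signChanges σ + 1) + 1))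

/-! ## Steps A–B of the line's glue, then the contradiction -/

/-- Steps A–B of `matrixDescartes_of_stubs`: the three statements give a bilinear-in-logs bound on the positive roots
of EVERY symmetric pencil. [this file] -/
theorem posRootCount_le_of_stubs (h₂ : PerturbToAlternation) (h₃ : SplitToSemidefinite)
    {a : ℕ} (ha : ∀ (K m : ℕ) (d : Fin K → ℕ) (σ : Fin K → Bool) (A : Fin K → Matrix (Fin m) (Fin m) ℝ),
      StrictMono d → (∀ l, (A l).PosSemidef) →
        posRootCount d (signed σ A) ≤ 2 ^ (a * (Nat.log 2 m + 1) * (Nat.log 2 (signChanges σ + 1) + 1)))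
    (K m : ℕ) (d : Fin K → ℕ) (S : Fin K → Matrix (Fin m) (Fin m) ℝ) (hS : ∀ l, (S l).IsSymm) :
    posRootCount d S ≤ 2 * 2 ^ (a * (Nat.log 2 m + 1) * (Nat.log 2 K + 2)) := by
  set L := Nat.log 2 K with hL
  set E : ℕ := a * (Nat.log 2 m + 1) * (L + 2) with hE
  have hsplitB : ∀ S' : Fin K → Matrix (Fin m) (Fin m) ℝ, (∀ l, (S' l).IsSymm) →
      ∀ (N : ℕ) (τ : Fin (N + 1) → ℝ), Alternates d S' N τ → N ≤ 2 ^ E := by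
    intro S' hS' N τ hA
    obtain ⟨K', d', σ, A, hK', hd', hA', hN⟩ := h₃ K m d S' hS' N τ hA
    refine hN.trans ((ha K' m d' σ A hd' hA').trans ?_)
    have hV : signChanges σ ≤ K' - 1 := signChanges_le σ
    have hlog : Nat.log 2 (signChanges σ + 1) ≤ L + 1 := by
      rcases Nat.eq_zero_or_pos K' with hK0 | hKpos
      · have h0 : signChanges σ = 0 := by omega
        simp [h0]
      · calc Nat.log 2 (signChanges σ + 1) ≤ Nat.log 2 (K * 2) := Nat.log_mono_right (by omega)
          _ = Nat.log 2 K + 1 := Nat.log_mul_base (by norm_num) (by omega)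
          _ = L + 1 := by rw [hL]
    have hlog' : Nat.log 2 (signChanges σ + 1) + 1 ≤ L + 2 := by omega
    calc 2 ^ (a * (Nat.log 2 m + 1) * (Nat.log 2 (signChanges σ + 1) + 1))
        ≤ 2 ^ (a * (Nat.log 2 m + 1) * (L + 2)) :=
          Nat.pow_le_pow_right (by norm_num) (Nat.mul_le_mul_left _ hlog')
      _ = 2 ^ E := by rw [hE]
  exact h₂ K m d (2 ^ E) hsplitB S hS

/-- **The stub set of `sign-split` is inconsistent**: the two T8 stubs refute the bilinear semidefinite rule
(via `Census.noGo_bilinearLogLaw`). [this file + kernel staircase] -/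
theorem not_bilinearSemidefiniteDescartes_of_split_perturb :
    SplitToSemidefinite → PerturbToAlternation → ¬ BilinearSemidefiniteDescartes := by
  intro h₃ h₂ h₄
  obtain ⟨a, ha⟩ := h₄
  apply Census.noGo_bilinearLogLaw
  refine ⟨2 * a + 2, fun m K d S hS => ?_⟩
  have h := posRootCount_le_of_stubs h₂ h₃ ha K m d S hS
  -- `posRootCount d S` is by definition the quantity bounded in `PosRootLawAt`
  show ((∑ l, (X : ℝ[X]) ^ d l • (S l).map Polynomial.C).det.roots.toFinset.filter (fun t => 0 < t)).card ≤ _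
  refine (show _ ≤ 2 * 2 ^ (a * (Nat.log 2 m + 1) * (Nat.log 2 K + 2)) from h).trans ?_
  have hx : (Nat.log 2 m + 1) * (Nat.log 2 K + 2) ≤ 2 * ((Nat.log 2 m + 1) * (Nat.log 2 K + 1)) := by
    nlinarith [Nat.zero_le (Nat.log 2 m), Nat.zero_le (Nat.log 2 K)]
  calc 2 * 2 ^ (a * (Nat.log 2 m + 1) * (Nat.log 2 K + 2))
      = 2 ^ (a * (Nat.log 2 m + 1) * (Nat.log 2 K + 2) + 1) := by rw [pow_succ]; ring
    _ ≤ 2 ^ ((2 * a + 2) * (Nat.log 2 m + 1) * (Nat.log 2 K + 1)) := by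
        apply Nat.pow_le_pow_right (by norm_num)
        have h1 : 1 ≤ (Nat.log 2 m + 1) * (Nat.log 2 K + 1) := Nat.one_le_iff_ne_zero.mpr (by positivity)
        nlinarith [hx, h1]

end Summit.ValiantsHypothesis.ValiantsHypothesis.Theorems.LacunarySymmetroidMatrixDescartes.Census.SignSplit
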